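import Summits.MatrixMultiplication.OmegaCensus.DicyclicFamiliesGeneral
import Summits.MatrixMultiplication.OmegaCensus.C2C2QuaternionGeneralLaw
import Summits.MatrixMultiplication.OmegaCensus.DicyclicLawRankThreeQuotientAll
import HarnessLib

/-!
# `C₂² × Q_{4m}`, `C₂³ × Q_{4m}`, `C₂² × (ℤ_n ⋊ ℤ₄)`: the dicyclic law is not attained — no lower bound on `m`, `n`

ω-census `pub-omega`, family (b3), seat pub-omega-group gen 15.  Framing: lottery ticket; floor = certified bounds/negative
ranges.  VALUE: kernel census clauses (group-theoretic method); NOT progress on ω.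

Gen 13's family clauses (`C2C2QuaternionGeneralLaw.lean`, `DicyclicFamiliesGeneral.lean`) carry `m ≥ 8` / `m ≥ 4` /
`n ≥ 8` because `no_dicyclic_law_of_rank_three_quot` needed `|A| ≥ 50`.  With `no_dicyclic_law_of_onto_f2cube`
(`DicyclicLawRankThreeQuotientAll.lean`: every `|A|`, and the quotient map is constructed internally, so no `π`/kernel
bookkeeping is needed) the same three characters give:
* `c2c2_quaternion_no_dicyclic_law_all_even`: **`C₂² × Q_{4m}`, every even `m ≥ 1`: `3|S||T||U| + 16 ≠ 64m`** — new member
  `m = 4`, `C₂² × Q₁₆` of order `64` (census row NR115: `β = 64` engine ×2; kernel now: law `80` not attained);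
* `c2c2c2_quaternion_no_dicyclic_law_all`: **`C₂³ × Q_{4m}`, every `m ≥ 1`: `3|S||T||U| + 16 ≠ 128m`** — new member `m = 2`,
  `C₂³ × Q₈` of order `64` (NR116);
* `c2c2_semidirect_no_dicyclic_law_all_even`: **`C₂² × (ℤ_n ⋊ ℤ₄)`, every even `n ≥ 1`: `3|S||T||U| + 16 ≠ 64n`** — new
  member `n = 4`, `C₂² × (ℤ₄ ⋊ ℤ₄)` of order `64` (NR120).
(For `m` odd resp. `n` odd the quotient `A/⟨c₀⟩` is cyclic-by-`2` and the law IS attained when `|A| ≡ 2 (mod 3)`: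
`c2_dicyclic_law_of_quot_cyclic`-type rows; the orders with `3 ∣ |A|` or `|A| ≡ 1 (mod 3)` are vacuous here.)
-/

namespace Summit.MatrixMultiplication.OmegaCensus

open Literature.Combinatorics.Additive Finset

section C2C2Q

variable {m : ℕ} [NeZero m]

/-- **`C₂² × Q_{4m}`, every even `m`: the dicyclic law is not attained.**  For every TPP triple `(S,T,U)` of `C₂² × Q_{4m}`:
`3|S||T||U| + 16 ≠ 64m`. [folklore] -/
theorem c2c2_quaternion_no_dicyclic_law_all_even (hm2 : 2 ∣ m)
    {S T U : Finset (Multiplicative (ZMod 2) × (Multiplicative (ZMod 2) × QuaternionGroup m))}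
    (h : TripleProductProperty S T U) : 3 * (S.card * T.card * U.card) + 16 ≠ 64 * m := by
  have hm0 : m ≠ 0 := NeZero.ne m
  haveI : NeZero (2 * m) := ⟨by omega⟩
  obtain ⟨hc₀', -⟩ := z2_z2_z2m_quot_noncyclic (m := m)
  refine c2_quaternion_presentation (m := m) fun ρ τ c₀ hρρ hρτ hτρ hττ hρ hτ hne hsurj hc => ?_
  subst hc
  refine c2_product_presentation hρρ hρτ hτρ hττ hρ hτ hne hsurj
    fun ρ' τ' c₀' hρρ' hρτ' hτρ' hττ' hρ' hτ' hne' hsurj' hc' => ?_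
  subst hc'
  have hcard : Fintype.card (ZMod 2 × (ZMod 2 × ZMod (2 * m))) = 8 * m := by
    rw [Fintype.card_prod, Fintype.card_prod, ZMod.card, ZMod.card]; ring
  -- the three characters `x`, `y`, `z mod 2`
  let ψ₁ : ZMod 2 × (ZMod 2 × ZMod (2 * m)) →+ ZMod 2 := AddMonoidHom.fst _ _
  let ψ₂ : ZMod 2 × (ZMod 2 × ZMod (2 * m)) →+ ZMod 2 := (AddMonoidHom.fst _ _).comp (AddMonoidHom.snd _ _)
  let ψ₃ : ZMod 2 × (ZMod 2 × ZMod (2 * m)) →+ ZMod 2 :=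
    (ZMod.castHom (show 2 ∣ 2 * m from dvd_mul_right 2 m) (ZMod 2)).toAddMonoidHom.comp
      ((AddMonoidHom.snd _ _).comp (AddMonoidHom.snd _ _))
  have hψ₃ : ∀ p : ZMod 2 × (ZMod 2 × ZMod (2 * m)),
      ψ₃ p = ZMod.castHom (show 2 ∣ 2 * m from dvd_mul_right 2 m) (ZMod 2) p.2.2 := fun p => rfl
  have hψc : ψ₁ (0, (0, (m : ZMod (2 * m)))) = 0 ∧ ψ₂ (0, (0, (m : ZMod (2 * m)))) = 0 ∧
      ψ₃ (0, (0, (m : ZMod (2 * m)))) = 0 := by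
    refine ⟨rfl, rfl, ?_⟩
    rw [hψ₃]
    show ZMod.castHom _ (ZMod 2) ((m : ℕ) : ZMod (2 * m)) = 0
    rw [map_natCast]; exact (ZMod.natCast_eq_zero_iff m 2).2 hm2
  have hψ : ∀ v : ZMod 2 × ZMod 2 × ZMod 2, ∃ x, (ψ₁ x, ψ₂ x, ψ₃ x) = v := by
    rintro ⟨v₁, v₂, v₃⟩
    refine ⟨(v₁, (v₂, ((v₃.val : ℕ) : ZMod (2 * m)))), ?_⟩
    simp only [Prod.mk.injEq]
    refine ⟨rfl, rfl, ?_⟩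
    rw [hψ₃]
    show ZMod.castHom _ (ZMod 2) ((v₃.val : ℕ) : ZMod (2 * m)) = v₃
    rw [map_natCast, ZMod.natCast_zmod_val]
  have key := no_dicyclic_law_of_onto_f2cube hρρ' hρτ' hτρ' hττ' hc₀' hρ' hτ' hne' hsurj' ψ₁ ψ₂ ψ₃ hψc hψ h
  rwa [hcard, show 8 * (8 * m) = 64 * m by ring] at key

/-- **`C₂² × Q₁₆` (`m = 4`, order `64`, census row NR115): no TPP triple attains `3|S||T||U| + 16 = 256`, i.e. the
dicyclic law `|S||T||U| = 80` is not attained.** [folklore] -/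
theorem c2c2_quaternion_16_no_dicyclic_law
    {S T U : Finset (Multiplicative (ZMod 2) × (Multiplicative (ZMod 2) × QuaternionGroup 4))}
    (h : TripleProductProperty S T U) : S.card * T.card * U.card ≠ 80 := by
  have := c2c2_quaternion_no_dicyclic_law_all_even (m := 4) ⟨2, rfl⟩ h
  omega

end C2C2Q

section C2CubeQ

variable {m : ℕ} [NeZero m]

/-- **`C₂³ × Q_{4m}`, every `m`: no TPP triple attains `3|S||T||U| + 16 = 128m`.** [folklore] -/
theorem c2c2c2_quaternion_no_dicyclic_law_all
    {S T U : Finset (Multiplicative (ZMod 2) × (Multiplicative (ZMod 2) × (Multiplicative (ZMod 2) × QuaternionGroup m)))}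
    (h : TripleProductProperty S T U) : 3 * (S.card * T.card * U.card) + 16 ≠ 128 * m := by
  have hm0 : m ≠ 0 := NeZero.ne m
  haveI : NeZero (2 * m) := ⟨by omega⟩
  obtain ⟨hc₀'', -⟩ := z2_z2_z2_z2m_quot_noncyclic (m := m)
  refine c2_quaternion_presentation (m := m) fun ρ τ c₀ hρρ hρτ hτρ hττ hρ hτ hne hsurj hc => ?_
  subst hc
  refine c2_product_presentation hρρ hρτ hτρ hττ hρ hτ hne hsurj
    fun ρ' τ' c₀' hρρ' hρτ' hτρ' hττ' hρ' hτ' hne' hsurj' hc' => ?_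
  subst hc'
  refine c2_product_presentation hρρ' hρτ' hτρ' hττ' hρ' hτ' hne' hsurj'
    fun ρ'' τ'' c₀'' hρρ'' hρτ'' hτρ'' hττ'' hρ'' hτ'' hne'' hsurj'' hc'' => ?_
  subst hc''
  have hcard : Fintype.card (ZMod 2 × (ZMod 2 × (ZMod 2 × ZMod (2 * m)))) = 16 * m := by
    rw [Fintype.card_prod, Fintype.card_prod, Fintype.card_prod, ZMod.card, ZMod.card]; ring
  -- the three `ℤ₂`-coordinates
  let A' := ZMod 2 × (ZMod 2 × (ZMod 2 × ZMod (2 * m)))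
  let ψ₁ : A' →+ ZMod 2 := AddMonoidHom.fst _ _
  let ψ₂ : A' →+ ZMod 2 := (AddMonoidHom.fst _ _).comp (AddMonoidHom.snd _ _)
  let ψ₃ : A' →+ ZMod 2 := (AddMonoidHom.fst _ _).comp ((AddMonoidHom.snd _ _).comp (AddMonoidHom.snd _ _))
  have hψc : ψ₁ (0, (0, (0, (m : ZMod (2 * m))))) = 0 ∧ ψ₂ (0, (0, (0, (m : ZMod (2 * m))))) = 0 ∧
      ψ₃ (0, (0, (0, (m : ZMod (2 * m))))) = 0 := ⟨rfl, rfl, rfl⟩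
  have hψ : ∀ v : ZMod 2 × ZMod 2 × ZMod 2, ∃ x, (ψ₁ x, ψ₂ x, ψ₃ x) = v := by
    rintro ⟨v₁, v₂, v₃⟩; exact ⟨(v₁, (v₂, (v₃, 0))), rfl⟩
  have key := no_dicyclic_law_of_onto_f2cube hρρ'' hρτ'' hτρ'' hττ'' hc₀'' hρ'' hτ'' hne'' hsurj'' ψ₁ ψ₂ ψ₃ hψc hψ h
  rwa [hcard, show 8 * (16 * m) = 128 * m by ring] at key

/-- **`C₂³ × Q₈` (`m = 2`, order `64`, census row NR116): no TPP triple attains `|S||T||U| = 80`.** [folklore] -/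
theorem c2c2c2_quaternion_8_no_dicyclic_law
    {S T U : Finset (Multiplicative (ZMod 2) × (Multiplicative (ZMod 2) × (Multiplicative (ZMod 2) × QuaternionGroup 2)))}
    (h : TripleProductProperty S T U) : S.card * T.card * U.card ≠ 80 := by
  have := c2c2c2_quaternion_no_dicyclic_law_all (m := 2) h
  omega

end C2CubeQ

section C2C2Semidirect

variable {n : ℕ} [NeZero n]

/-- **`C₂² × (ℤ_n ⋊ ℤ₄)`, every even `n`: no TPP triple attains `3|S||T||U| + 16 = 64n`.** [folklore] -/
theorem c2c2_semidirect_no_dicyclic_law_all_even (h2n : 2 ∣ n)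
    {S T U : Finset (Multiplicative (ZMod 2) ×
      (Multiplicative (ZMod 2) × DihedralLikeGroup (ZMod 2 × ZMod n) ((1 : ZMod 2), 0)))}
    (h : TripleProductProperty S T U) : 3 * (S.card * T.card * U.card) + 16 ≠ 64 * n := by
  obtain ⟨hc₀', -⟩ := z2_z2_z2_zn_quot_noncyclic (n := n)
  refine c2_semidirect_presentation (n := n) fun ρ τ c₀ hρρ hρτ hτρ hττ hρ hτ hne hsurj hc => ?_
  subst hc
  refine c2_product_presentation hρρ hρτ hτρ hττ hρ hτ hne hsurj
    fun ρ' τ' c₀' hρρ' hρτ' hτρ' hττ' hρ' hτ' hne' hsurj' hc' => ?_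
  subst hc'
  have hcard : Fintype.card (ZMod 2 × (ZMod 2 × (ZMod 2 × ZMod n))) = 8 * n := by
    rw [Fintype.card_prod, Fintype.card_prod, Fintype.card_prod, ZMod.card, ZMod.card]; ring
  let A' := ZMod 2 × (ZMod 2 × (ZMod 2 × ZMod n))
  -- characters `x`, `y`, `z mod 2`
  let ψ₁ : A' →+ ZMod 2 := AddMonoidHom.fst _ _
  let ψ₂ : A' →+ ZMod 2 := (AddMonoidHom.fst _ _).comp (AddMonoidHom.snd _ _)
  let ψ₃ : A' →+ ZMod 2 := (ZMod.castHom h2n (ZMod 2)).toAddMonoidHom.comp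
    ((AddMonoidHom.snd _ _).comp ((AddMonoidHom.snd _ _).comp (AddMonoidHom.snd _ _)))
  have hψ₃ : ∀ p : A', ψ₃ p = ZMod.castHom h2n (ZMod 2) p.2.2.2 := fun p => rfl
  have hψc : ψ₁ (0, (0, (1, (0 : ZMod n)))) = 0 ∧ ψ₂ (0, (0, (1, (0 : ZMod n)))) = 0 ∧
      ψ₃ (0, (0, (1, (0 : ZMod n)))) = 0 := by
    refine ⟨rfl, rfl, ?_⟩
    rw [hψ₃]; exact map_zero _
  have hψ : ∀ v : ZMod 2 × ZMod 2 × ZMod 2, ∃ x, (ψ₁ x, ψ₂ x, ψ₃ x) = v := by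
    rintro ⟨v₁, v₂, v₃⟩
    refine ⟨(v₁, (v₂, (0, ((v₃.val : ℕ) : ZMod n)))), ?_⟩
    simp only [Prod.mk.injEq]
    refine ⟨rfl, rfl, ?_⟩
    rw [hψ₃]
    show ZMod.castHom _ (ZMod 2) ((v₃.val : ℕ) : ZMod n) = v₃
    rw [map_natCast, ZMod.natCast_zmod_val]
  have key := no_dicyclic_law_of_onto_f2cube hρρ' hρτ' hτρ' hττ' hc₀' hρ' hτ' hne' hsurj' ψ₁ ψ₂ ψ₃ hψc hψ h
  rwa [hcard, show 8 * (8 * n) = 64 * n by ring] at key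

/-- **`C₂² × (ℤ₄ ⋊ ℤ₄)` (`n = 4`, order `64`, census row NR120): no TPP triple attains `|S||T||U| = 80`.** [folklore] -/
theorem c2c2_semidirect_4_no_dicyclic_law
    {S T U : Finset (Multiplicative (ZMod 2) ×
      (Multiplicative (ZMod 2) × DihedralLikeGroup (ZMod 2 × ZMod 4) ((1 : ZMod 2), 0)))}
    (h : TripleProductProperty S T U) : S.card * T.card * U.card ≠ 80 := by
  have := c2c2_semidirect_no_dicyclic_law_all_even (n := 4) ⟨2, rfl⟩ h
  omega

end C2C2Semidirect

end Summit.MatrixMultiplication.OmegaCensus
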